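import Summits.BirchSwinnertonDyer.BirchSwinnertonDyer.Theorems.Rank2ObservatoryRank3TwoDescRows113
import HarnessLib

/-!
# BirchSwinnertonDyer — rank ≥ 2 observatory: KERNEL-2DESC rank-3 CENSUS AGGREGATE, part 10 (1 rows, join files 113–113)

HONEST FRAMING: per-curve certified theorems and census instruments; no claim on BSD in rank ≥ 2.

Part 10 of the aggregate `Rank2ObservatoryRank3TwoDescCensus` (split for the 400-line file limit): `Part10.rows` (DATA) = the
1 rows of `rank3Table` joined by `Rank2ObservatoryRank3TwoDescRows113 … 113` (1 files), as the right-nested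
concatenation of per-file lists `rowsKKK` (each written once, verbatim the join file's list).  `mem_rank3Table` and
`rank_eq_three : ∀ r ∈ rows, rank_ℤ(E_r(ℚ)) = 3` hold with NO hypothesis: glued by `List.forall_mem_append` from the join
files' per-file `forall_rank_eq_three` (which apply to `rowsKKK` by definitional unfolding) and per-row
`C<label>.row_mem_rank3Table`.  No certificate is re-checked here.  Sorry-free.
[cite: CremonaAlgorithms1997, Tables, §3.5] [cite: Cassels1991LecturesEllipticCurves, §15]
-/

-- single-conjunct summit: `Summit.BirchSwinnertonDyer.BirchSwinnertonDyer.…` repeats the name by design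
set_option linter.dupNamespace false
-- deep literal lists: raise the recursion budget for the whole file
set_option maxRecDepth 400000

namespace Summit.BirchSwinnertonDyer.BirchSwinnertonDyer.Rank2Observatory.TwoDescRank3Census.Part10

open Literature Literature.NumberTheory.EllipticCurves WeierstrassCurve

/-- `∀`-over-membership is additive under `++`. -/
private theorem forall_app {P : Rank3Row → Prop} {l₁ l₂ : List Rank3Row} (h₁ : ∀ r ∈ l₁, P r) (h₂ : ∀ r ∈ l₂, P r) :
    ∀ r ∈ l₁ ++ l₂, P r :=
  List.forall_mem_append.2 ⟨h₁, h₂⟩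

/-- DATA: the 1 rows of join file `…Rows113`. -/
def rows113 : List Rank3Row :=
 [⟨"446967a1", 0, 0, 1, -183, 810, 446967, -11, 409504, (5, 4, 1), (14, 31, 1), (-1, 31, 1)⟩]

/-- every row of `rows113` is a row of `rank3Table` (per-row `C<label>.row_mem_rank3Table`). -/
private theorem mem_113 : ∀ r ∈ rows113, r ∈ rank3Table := by
  unfold rows113
  simp only [List.mem_cons, List.not_mem_nil, or_false, forall_eq]
  exact C446967a1.row_mem_rank3Table

/-- DATA: the 1 rows of this part = `rows113 ++ (… ++ rows113)` (right-nested, file order). -/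
def rows : List Rank3Row :=
  rows113

/-- `rows.length = 1`. -/
theorem rows_length : rows.length = 1 := by
  decide +kernel

/-- **Every row of this part is a row of the census table `rank3Table`.** [cite: CremonaAlgorithms1997, Tables] -/
theorem mem_rank3Table : ∀ r ∈ rows, r ∈ rank3Table := by
  unfold rows
  exact mem_113

/-- **`rank_ℤ E_r(ℚ) = 3` for every row of this part, NO hypothesis** (kernel 2-descent upper bound + kernel point
certificate, per row). [cite: Cassels1991LecturesEllipticCurves, §15] [cite: CremonaAlgorithms1997, §3.5] -/
theorem rank_eq_three : ∀ r ∈ rows, r.curve.mordellWeilRank = 3 := by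
  unfold rows rows113
  exact Rank3TwoDescRows113.forall_rank_eq_three

/-- Both facts per row of this part. [cite: CremonaAlgorithms1997, Tables] -/
theorem rank_eq_three_and_mem : ∀ r ∈ rows, r ∈ rank3Table ∧ r.curve.mordellWeilRank = 3 :=
  fun r hr => ⟨mem_rank3Table r hr, rank_eq_three r hr⟩

end Summit.BirchSwinnertonDyer.BirchSwinnertonDyer.Rank2Observatory.TwoDescRank3Census.Part10
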